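import Summits.Ventures.Crystal3D.Bulk.RotSysEuler
import HarnessLib

/-!
# Edges leaving a dart set / a component of a sub-rotation-system, and adding one edge
# (generic helpers for the Gauss–Bonnet induction of `Bulk/RotSysGaussBonnet.lean`)

HONEST FRAMING. Part of the venture `Summits/Ventures/Crystal3D` (cell `pub-crystal3d`, phase 2;
seat p3), PURELY COMBINATORIAL and generic (folklore): no geometry. For a loopless rotation
system `(σ, α)` that is CONNECTED on its full dart set (`conn σ α univ x y` for all `x, y`) and an
`α`-closed `S`:

* **`IsRotSys.exists_dart_out`** — if `S ≠ univ` is nonempty, some dart `z ∉ S` sits at a vertex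
  carrying a dart of `S` (membership in `S` cannot be invariant along all ambient connections);
* **`IsRotSys.exists_bridge_dart`** — if `x, y ∈ S` are not `S`-connected, some dart `z ∉ S`
  sits at a vertex of the component of `x` while no dart of `S` at the vertex of `α z` is in
  that component (an ambient edge LEAVING the component);
* `exists_not_conn_of_numK_ne_one`; adding the edge `{z, α z}`: `IsRotSys.isClosed_union_pair`,
  `IsRotSys.union_pair_sdiff`, `card_univ_sdiff_union_pair_lt`; `IsRotSys.chi2_eq_of_planar`
  (sub-maps of a planar map are planar, from `RotSys.IsRotSys.chi2_eq_of_subset`).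

Nothing here mentions GAP(1.26).
-/

namespace Summit.Ventures.Crystal3D

namespace RotSys

open Equiv Equiv.Perm Finset

open scoped Classical

variable {D : Type*} [DecidableEq D] [Fintype D] {σ α : Perm D}

/-! ## Edges leaving a dart set -/

/-- **An edge out of `S`.** In a connected rotation system, if `S` is `α`-closed, `x ∈ S` and
`y ∉ S`, some dart `z ∉ S` sits at a vertex carrying a dart of `S`. -/
theorem IsRotSys.exists_dart_out (h : IsRotSys σ α) (hconn : ∀ x y : D, conn σ α univ x y)
    {S : Finset D} (hS : IsClosed α S) {x y : D} (hx : x ∈ S) (hy : y ∉ S) :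
    ∃ z, z ∉ S ∧ ∃ x' ∈ S, σ.SameCycle z x' := by
  by_contra hno
  push Not at hno
  -- then membership in `S` is invariant along every ambient connection
  have key : ∀ a b, conn σ α univ a b → (a ∈ S ↔ b ∈ S) := by
    intro a b hab
    induction hab with
    | rel a b hab =>
      obtain ⟨-, -, hadj⟩ := hab
      rcases hadj with hc | he
      · constructor
        · intro ha
          by_contra hb
          exact hno b hb a ha hc.symm
        · intro hb
          by_contra ha
          exact hno a ha b hb hc
      · subst he
        constructor
        · exact hS a
        · intro hb
          have := hS _ hb
          rwa [h.α_inv] at this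
    | refl a => exact Iff.rfl
    | symm a b _ ih => exact ih.symm
    | trans a b c _ _ ih1 ih2 => exact ih1.trans ih2
  exact hy ((key x y (hconn x y)).1 hx)

/-- **An edge leaving a component.** In a connected rotation system, if `S` is `α`-closed and
`x, y ∈ S` are NOT `S`-connected, some dart `z ∉ S` sits at a vertex of the component of `x`
while NO dart of `S` at the vertex of `α z` is `S`-connected to `x`. -/
theorem IsRotSys.exists_bridge_dart (h : IsRotSys σ α) (hconn : ∀ x y : D, conn σ α univ x y)
    {S : Finset D} (hS : IsClosed α S) {x y : D} (hx : x ∈ S) (hy : y ∈ S)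
    (hxy : ¬ conn σ α S x y) :
    ∃ z, z ∉ S ∧ (∃ x' ∈ S, conn σ α S x x' ∧ σ.SameCycle z x') ∧
      ∀ y' ∈ S, σ.SameCycle (α z) y' → ¬ conn σ α S x y' := by
  -- `Q a`: the vertex of `a` carries a dart of the component of `x`
  set Q : D → Prop := fun a => ∃ x' ∈ S, conn σ α S x x' ∧ σ.SameCycle a x' with hQ
  by_contra hno
  have hstep : ∀ z, z ∉ S → Q z → Q (α z) := by
    intro z hz hQz
    by_contra hQα
    apply hno
    refine ⟨z, hz, hQz, fun y' hy' hc hc' => hQα ⟨y', hy', hc', hc⟩⟩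
  -- a dart of `S` whose vertex is in the component has its edge in the component
  have hin : ∀ a, a ∈ S → Q a → Q (α a) := by
    rintro a ha ⟨x', hx', hc, hsc⟩
    have hxa : conn σ α S x a := conn_trans hc (conn_of_sameCycle hx' ha hsc.symm)
    exact ⟨α a, hS a ha, conn_trans hxa (conn_alpha hS ha), SameCycle.refl _ _⟩
  have hQα : ∀ a, Q a → Q (α a) := fun a hQa =>
    if ha : a ∈ S then hin a ha hQa else hstep a ha hQa
  have key : ∀ a b, conn σ α univ a b → (Q a ↔ Q b) := by
    intro a b hab
    induction hab with
    | rel a b hab =>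
      obtain ⟨-, -, hadj⟩ := hab
      rcases hadj with hc | he
      · constructor
        · rintro ⟨x', hx', hcx, hsc⟩; exact ⟨x', hx', hcx, hc.symm.trans hsc⟩
        · rintro ⟨x', hx', hcx, hsc⟩; exact ⟨x', hx', hcx, hc.trans hsc⟩
      · subst he
        constructor
        · exact hQα a
        · intro hb
          have := hQα _ hb
          rwa [h.α_inv] at this
    | refl a => exact Iff.rfl
    | symm a b _ ih => exact ih.symm
    | trans a b c _ _ ih1 ih2 => exact ih1.trans ih2
  have hQx : Q x := ⟨x, hx, conn_refl σ α S x, SameCycle.refl _ x⟩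
  obtain ⟨x', hx', hc, hsc⟩ := (key x y (hconn x y)).1 hQx
  exact hxy (conn_trans hc (conn_of_sameCycle hx' hy hsc.symm))

/-! ## Small counting helpers -/

omit [Fintype D] in
/-- If `numK S ≠ 1` for a nonempty `S`, two darts of `S` are not `S`-connected. -/
theorem exists_not_conn_of_numK_ne_one {S : Finset D} (hne : S.Nonempty)
    (hK : numK σ α S ≠ 1) : ∃ x ∈ S, ∃ y ∈ S, ¬ conn σ α S x y := by
  by_contra hall
  push Not at hall
  apply hK
  unfold numK numClasses
  have : S.image (fun x => S.filter fun y => conn σ α S x y) = {S} := by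
    ext A
    rw [mem_image, mem_singleton]
    constructor
    · rintro ⟨x, hx, rfl⟩
      ext y
      rw [mem_filter]
      exact ⟨fun hy => hy.1, fun hy => ⟨hy, hall x hx y hy⟩⟩
    · rintro rfl
      obtain ⟨x, hx⟩ := hne
      refine ⟨x, hx, ?_⟩
      ext y
      rw [mem_filter]
      exact ⟨fun hy => hy.1, fun hy => ⟨hy, hall x hx y hy⟩⟩
  rw [this, card_singleton]

omit [Fintype D] in
/-- Adding the edge `{z, α z}` (`z ∉ S`) to an `α`-closed `S`: the new set is `α`-closed, -/
theorem IsRotSys.isClosed_union_pair (h : IsRotSys σ α) {S : Finset D} (hS : IsClosed α S)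
    (z : D) : IsClosed α (S ∪ {z, α z}) := by
  intro x hx
  rw [mem_union, mem_insert, mem_singleton] at hx ⊢
  rcases hx with hx | rfl | rfl
  · exact Or.inl (hS x hx)
  · exact Or.inr (Or.inr rfl)
  · rw [h.α_inv]; exact Or.inr (Or.inl rfl)

omit [Fintype D] in
/-- … removing the edge again gives back `S`, -/
theorem IsRotSys.union_pair_sdiff (h : IsRotSys σ α) {S : Finset D} (hS : IsClosed α S) {z : D}
    (hz : z ∉ S) : (S ∪ {z, α z}) \ {z, α z} = S := by
  have hαz : α z ∉ S := fun hmem => hz (by have := hS _ hmem; rwa [h.α_inv] at this)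
  ext x
  rw [Finset.mem_sdiff, mem_union, mem_insert, mem_singleton]
  constructor
  · rintro ⟨hx | hx, hno⟩
    · exact hx
    · exact absurd hx hno
  · intro hx
    exact ⟨Or.inl hx, fun hh => by rcases hh with rfl | rfl <;> [exact hz hx; exact hαz hx]⟩

/-- … and the complement shrinks. -/
theorem card_univ_sdiff_union_pair_lt {S : Finset D} {z : D} (hz : z ∉ S) :
    (univ \ (S ∪ {z, α z})).card < (univ \ S).card := by
  apply Finset.card_lt_card
  refine ⟨fun x hx => ?_, fun hsub => ?_⟩
  · rw [Finset.mem_sdiff] at hx ⊢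
    exact ⟨hx.1, fun hxS => hx.2 (mem_union_left _ hxS)⟩
  · have : z ∈ univ \ (S ∪ {z, α z}) := hsub (Finset.mem_sdiff.2 ⟨mem_univ z, hz⟩)
    rw [Finset.mem_sdiff, mem_union, mem_insert] at this
    exact this.2 (Or.inr (Or.inl rfl))

/-- Every `α`-closed sub-map of a planar rotation system is planar. -/
theorem IsRotSys.chi2_eq_of_planar (h : IsRotSys σ α)
    (hplanar : chi2 σ α univ = 4 * (numK σ α univ : ℤ)) {S : Finset D} (hS : IsClosed α S) :
    chi2 σ α S = 4 * (numK σ α S : ℤ) :=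
  h.chi2_eq_of_subset (fun x _ => mem_univ (α x)) hS (subset_univ S) hplanar

end RotSys

end Summit.Ventures.Crystal3D
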